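import Summits.AtomisticToContinuum.HydrodynamicLimit.Theorems.RelayRaceLocalityLightConeInLawSVCCountFamilyLCLT
import Summits.AtomisticToContinuum.HydrodynamicLimit.Theorems.RelayRaceLocalityLightConeInLawSVCCountWeightFamily
import Summits.AtomisticToContinuum.HydrodynamicLimit.Theorems.RelayRaceLocalityLightConeInLawSVCRatioLipschitz

/-!
# Stub `stub_countLCLT` of the line `susceptibility-variance-continuity` for the crux `LightConeInLaw`
(stmt-AtomisticToContinuum-12500; route `RelayRaceLocality`, sub-problem `HydrodynamicLimit`)

**Local central-limit statics of the Poissonised count law** `p_{N,μ}(n) ∝ μⁿ Z_{N,n}/n!` of the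
low-activity hard-sphere gas on `𝕋³` with an inhomogeneous continuous activity profile: on the window of
activities whose mean count is `≍ (σ₂/σ₁)³ (N+1)`, (b) the count variance is two-sided linear,
`s₀(N+1) ≤ Var ≤ s₁(N+1)`, and (c) `√(N+1) p_{N,μ}(n) ≥ c₀` at `|n - mean| ≤ 1`.

Assembly of the helper files of the same namespace:
* `…SVCCountWeightFamily`: the count law is a count family, `(n+1) p(n+1) = ν g(n) p(n)` with `ν = μ ∫a₂`
  and insertion probabilities `g(n) = Ξ(n+1)/Ξ(n)`, `Ξ(n)` the hard-core probability of `n` independent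
  points of law `a₂/∫a₂` at the diameter `ε_N = hsDiameter σ₁ N`;
* `…SVCRatioLipschitz` (the cluster-expansion input, read at `K(N+1)` labels with `K ≍ (σ₂/σ₁)³` through
  `hsDiameter_rescale`): `g ≥ 1 - λ` and `|g(n+1) - g(n)| ≤ 64e²λ/(K(N+1))` on `[0, K(N+1) - 1]`,
  `λ = K M v₁ σ₁³ = O(σ₀³)` (`insertion_structure`);
* `…SVCCountFamilyMoments` (`mean_le`, `mean_ge`): a priori `(N+1)(σ₂/σ₁)³/2 ≤ ν ≤ 4 (σ₂/σ₁)³ (N+1)` on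
  the window;
* `…SVCCountFamilyVariance` (`countFamily_variance`): `ν/4 ≤ Var ≤ 2ν`;
* `…SVCCountFamilyLCLT` (`countFamily_lclt`): `√ν p(n) ≥ c` at `|n - mean| ≤ 1`.
References: D. Ruelle, *Statistical Mechanics* (1969) Ch. 4; E. Pulvirenti, D. Tsagkarogiannis, Comm. Math.
Phys. 316 (2012); R. L. Dobrushin, B. Tirozzi, Comm. Math. Phys. 54 (1977) 173–192.
-/

namespace Summit.AtomisticToContinuum.HydrodynamicLimit.Theorems.LightConeInLawSVC.CountLCLT

open scoped BigOperators Topology Classical ENNReal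
open Filter MeasureTheory
open Literature.MathematicalPhysics.KineticTheory Literature.Analysis.FluidPDE Literature.Analysis.FunctionSpaces
open Literature.Probability.LatticeModels Literature.MathematicalPhysics.StatisticalMechanics
open Summit.AtomisticToContinuum.HydrodynamicLimit.Theorems.LightConeInLawSketch
open Summit.AtomisticToContinuum.HydrodynamicLimit.Theorems.LightConeInLawSVC

noncomputable section

/-- **The insertion probabilities of the canonical hard-core gas along the scaling**: at small reduced density,
`g(n) = Ξ(n+1)/Ξ(n) ≥ 1 - λ` for `n ≤ N` and `|g(n+1) - g(n)| ≤ 64e²λ/(N+1)` for `n < N`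
(`XiN_mul_le_succ`, `hs_insertionRatio_lipschitz`, marginalisation `Xi_eq_Xi_self`). [folklore] -/
theorem insertion_structure {P : DensityProfile} {σ : ℝ} (h : SmallDensity P σ)
    (hsmall : ovDensity P σ ≤ 1 / (64 * Real.exp 1 ^ 2)) (N : ℕ) :
    (∀ n, n ≤ N → 1 - ovDensity P σ ≤
        Xi P (hsDiameter σ N) (n + 1) (n + 1) / Xi P (hsDiameter σ N) n n) ∧
    (∀ n, n < N → |Xi P (hsDiameter σ N) (n + 1 + 1) (n + 1 + 1) / Xi P (hsDiameter σ N) (n + 1) (n + 1) -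
        Xi P (hsDiameter σ N) (n + 1) (n + 1) / Xi P (hsDiameter σ N) n n| ≤
        64 * Real.exp 1 ^ 2 * ovDensity P σ / ((N + 1 : ℕ) : ℝ)) := by
  have hl1 := h.ovDensity_lt_one
  have hXi : ∀ n, n ≤ N + 1 → Xi P (hsDiameter σ N) n n = XiN P σ N n := fun n hn => by
    rw [XiN, Xi_eq_Xi_self P _ hn]
  have hg : ∀ n, n ≤ N →
      Xi P (hsDiameter σ N) (n + 1) (n + 1) / Xi P (hsDiameter σ N) n n = (qN P σ N n)⁻¹ := by
    intro n hn; rw [hXi (n + 1) (by omega), hXi n (by omega), qN, inv_div]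
  constructor
  · intro n hn
    rw [hg n hn, qN, inv_div, le_div_iff₀ (XiN_pos h.σ_pos.le h.σ_lt_half hl1 (by omega))]
    have := XiN_mul_le_succ h.σ_pos.le h.σ_lt_half (P := P) (N := N) (m := n) hn
    linarith
  · intro n hn
    rw [hg (n + 1) (by omega), hg n (by omega)]
    have hq0 := one_le_qN h.σ_pos.le h.σ_lt_half hl1 (P := P) (N := N) (m := n) (by omega)
    have hq1 := one_le_qN h.σ_pos.le h.σ_lt_half hl1 (P := P) (N := N) (m := n + 1) (by omega)
    have H := hs_insertionRatio_lipschitz P σ h hsmall N n (by omega)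
    have hq0' : 0 < qN P σ N n := by linarith
    have hq1' : 0 < qN P σ N (n + 1) := by linarith
    have e : (qN P σ N (n + 1))⁻¹ - (qN P σ N n)⁻¹ =
        (qN P σ N n - qN P σ N (n + 1)) / (qN P σ N n * qN P σ N (n + 1)) := by
      field_simp
    rw [e, abs_div, abs_of_pos (mul_pos hq0' hq1'), abs_sub_comm]
    calc |qN P σ N (n + 1) - qN P σ N n| / (qN P σ N n * qN P σ N (n + 1))
        ≤ |qN P σ N (n + 1) - qN P σ N n| / 1 :=
          div_le_div_of_nonneg_left (abs_nonneg _) one_pos (one_le_mul_of_one_le_of_one_le hq0 hq1)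
      _ ≤ _ := by rw [div_one]; exact H

/-- **The reduced density of the rescaled system**: `ovDensity P (ε_N (K(N+1))^{1/3}) = K · M v₁ σ₁³`
for `ε_N = hsDiameter σ₁ N`. [folklore] -/
theorem ovDensity_rescale (P : DensityProfile) (σ₁ : ℝ) (N K : ℕ) :
    ovDensity P (hsDiameter σ₁ N * (((K * (N + 1) : ℕ) : ℝ)) ^ (1 / 3 : ℝ)) = K * (P.M * v₁ * σ₁ ^ 3) := by
  rw [ovDensity, rescale_pow_three, hsDiameter_pow_three]
  have hN : ((N + 1 : ℕ) : ℝ) ≠ 0 := by positivity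
  push_cast
  field_simp

set_option maxHeartbeats 800000 in
/-- STUB `stub_countLCLT` of the line `susceptibility-variance-continuity` (registered signature verbatim).
**LOCAL CENTRAL-LIMIT STATICS OF THE POISSONISED COUNT LAW** of the low-activity hard-sphere gas on `𝕋³`
with the inhomogeneous profile `(a₂, u₂, θ₂)`: for `σ₁, σ₂ < σ₀(a₂)` there are `κ, s₀, s₁, c₀ > 0` and `N₀`
such that for `N ≥ N₀` and every activity whose mean count lies in the window
`[(1-κ)(σ₂/σ₁)³(N+1), (1+κ)(σ₂/σ₁)³(N+1)]`: (b) `s₀(N+1) ≤ varCount ≤ s₁(N+1)`; (c)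
`c₀ ≤ √(N+1) · countWeight … n` for `|n - meanCount| ≤ 1`. Proof: the count law is a count family
(`countWeight_countFamily`) whose insertion probabilities are `≥ 1 - λ` and `64e²λ/(K(N+1))`-Lipschitz on
`[0, K(N+1) - 1]`, `K = ⌈24(σ₂/σ₁)³⌉ + 2`, `λ = K M v₁ σ₁³ ≤ 1/(128e²)` (`insertion_structure` at the rescaled
reduced diameter, `hs_insertionRatio_lipschitz`); the window pins the activity, `ν ≍ (σ₂/σ₁)³(N+1)`
(`mean_le`, `mean_ge`); conclude by `countFamily_variance` and `countFamily_lclt`.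
[cite: PulvirentiTsagkarogiannis2012, Thm 2.1] -/
theorem stub_countLCLT :
    ∀ (a₂ θ₂ : T3 → ℝ) (u₂ : T3 → V3), Continuous a₂ → Continuous θ₂ → Continuous u₂ →
      (∀ x, 0 < a₂ x) → (∀ x, 0 < θ₂ x) →
    ∃ σ₀ : ℝ, 0 < σ₀ ∧ ∀ (σ₁ σ₂ : ℝ), 0 < σ₁ → σ₁ < σ₀ → 0 < σ₂ → σ₂ < σ₀ →
    ∃ κ : ℝ, 0 < κ ∧ ∃ s₀ : ℝ, 0 < s₀ ∧ ∃ s₁ : ℝ, 0 < s₁ ∧ ∃ c₀ : ℝ, 0 < c₀ ∧ ∃ N₀ : ℕ,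
    ∀ N : ℕ, N₀ ≤ N → ∀ μ : ℝ, 0 < μ →
        (1 - κ) * ((σ₂ / σ₁) ^ 3 * ((N + 1 : ℕ) : ℝ)) ≤ meanCount σ₁ (localGibbsProfile a₂ u₂ θ₂) μ N →
        meanCount σ₁ (localGibbsProfile a₂ u₂ θ₂) μ N ≤ (1 + κ) * ((σ₂ / σ₁) ^ 3 * ((N + 1 : ℕ) : ℝ)) →
        s₀ * ((N + 1 : ℕ) : ℝ) ≤ varCount σ₁ (localGibbsProfile a₂ u₂ θ₂) μ N ∧
        varCount σ₁ (localGibbsProfile a₂ u₂ θ₂) μ N ≤ s₁ * ((N + 1 : ℕ) : ℝ) ∧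
        ∀ n : ℕ, |(n : ℝ) - meanCount σ₁ (localGibbsProfile a₂ u₂ θ₂) μ N| ≤ 1 →
          c₀ ≤ Real.sqrt ((N + 1 : ℕ) : ℝ) * countWeight σ₁ (localGibbsProfile a₂ u₂ θ₂) μ N n := by
  intro a₂ θ₂ u₂ ha hθ hu ha0 hθ0
  -- data attached to the profile
  have hcI0 : 0 < ∫ y, a₂ y := integral_pos_of_continuous_pos ha ha0
  obtain ⟨σs, hσs, hSD⟩ := exists_smallDensity (profileOf a₂ ha ha0) one_pos
  obtain ⟨ν₀, hν₀, cL, hcL, HL⟩ := countFamily_lclt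
  have hM0 : 0 < (profileOf a₂ ha ha0).M := (profileOf a₂ ha ha0).M_pos
  have hMv : 0 < (profileOf a₂ ha ha0).M * v₁ := mul_pos hM0 v₁_pos
  have he2 : (2 : ℝ) ≤ Real.exp 1 := by linarith [Real.add_one_le_exp (1 : ℝ)]
  obtain ⟨Λ, hΛdef⟩ : ∃ Λ : ℝ, Λ = 3456 * Real.exp 1 ^ 2 * ((profileOf a₂ ha ha0).M * v₁) := ⟨_, rfl⟩
  have hΛ : 0 < Λ := by rw [hΛdef]; positivity
  obtain ⟨σ₀, hσ₀def⟩ : ∃ σ₀ : ℝ, σ₀ = min 1 (min (σs / 3) (1 / Λ)) := ⟨_, rfl⟩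
  have hσ₀pos : 0 < σ₀ := by rw [hσ₀def]; exact lt_min one_pos (lt_min (by positivity) (by positivity))
  have hσ₀1 : σ₀ ≤ 1 := by rw [hσ₀def]; exact min_le_left _ _
  have hσ₀s : σ₀ ≤ σs / 3 := by rw [hσ₀def]; exact (min_le_right _ _).trans (min_le_left _ _)
  have hσ₀Λ : σ₀ ≤ 1 / Λ := by rw [hσ₀def]; exact (min_le_right _ _).trans (min_le_right _ _)
  refine ⟨σ₀, hσ₀pos, ?_⟩
  intro σ₁ σ₂ hσ₁ hσ₁0 hσ₂ hσ₂0
  obtain ⟨q, hqdef⟩ : ∃ q : ℝ, q = (σ₂ / σ₁) ^ 3 := ⟨_, rfl⟩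
  have hq : 0 < q := by rw [hqdef]; positivity
  have hqσ : q * σ₁ ^ 3 = σ₂ ^ 3 := by rw [hqdef, div_pow, div_mul_cancel₀ _ (by positivity)]
  obtain ⟨K, hKdef⟩ : ∃ K : ℕ, K = ⌈24 * q⌉₊ + 2 := ⟨_, rfl⟩
  have hK1 : 24 * q + 2 ≤ (K : ℝ) := by
    rw [hKdef]; push_cast; linarith only [Nat.le_ceil (24 * q)]
  have hK2 : (K : ℝ) < 24 * q + 3 := by
    rw [hKdef]; push_cast; linarith only [Nat.ceil_lt_add_one (by positivity : (0 : ℝ) ≤ 24 * q)]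
  have hK0 : (0 : ℝ) < K := by linarith only [hK1, hq]
  have hKnat : 1 ≤ K := by rw [hKdef]; omega
  -- the reduced density `λ = K M v₁ σ₁³ ≤ 1/(128 e²)`
  have hσ₀3 : σ₀ ^ 3 ≤ σ₀ := by
    calc σ₀ ^ 3 = σ₀ * (σ₀ * σ₀) := by ring
      _ ≤ σ₀ * 1 := mul_le_mul_of_nonneg_left (mul_le_one₀ hσ₀1 hσ₀pos.le hσ₀1) hσ₀pos.le
      _ = σ₀ := mul_one _
  have hσ₂3 : σ₂ ^ 3 < σ₀ ^ 3 := pow_lt_pow_left₀ hσ₂0 hσ₂.le (by norm_num)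
  have hσ₁3 : σ₁ ^ 3 < σ₀ ^ 3 := pow_lt_pow_left₀ hσ₁0 hσ₁.le (by norm_num)
  have hKσ : (K : ℝ) * σ₁ ^ 3 < 27 * σ₀ ^ 3 := by
    have h1 : (K : ℝ) * σ₁ ^ 3 < (24 * q + 3) * σ₁ ^ 3 := mul_lt_mul_of_pos_right hK2 (by positivity)
    have h2 : (24 * q + 3) * σ₁ ^ 3 = 24 * σ₂ ^ 3 + 3 * σ₁ ^ 3 := by rw [← hqσ]; ring
    linarith only [h1, h2, hσ₂3, hσ₁3]
  have hlam : (K : ℝ) * ((profileOf a₂ ha ha0).M * v₁ * σ₁ ^ 3) ≤ 1 / (128 * Real.exp 1 ^ 2) := by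
    have h1 : (K : ℝ) * ((profileOf a₂ ha ha0).M * v₁ * σ₁ ^ 3) =
        ((profileOf a₂ ha ha0).M * v₁) * ((K : ℝ) * σ₁ ^ 3) := by ring
    rw [h1]
    have h2 : (K : ℝ) * σ₁ ^ 3 ≤ 27 * (1 / Λ) := by linarith only [hKσ, hσ₀3, hσ₀Λ]
    have hM0' : (profileOf a₂ ha ha0).M ≠ 0 := hM0.ne'
    have hv0 : v₁ ≠ 0 := v₁_pos.ne'
    calc ((profileOf a₂ ha ha0).M * v₁) * ((K : ℝ) * σ₁ ^ 3)
        ≤ ((profileOf a₂ ha ha0).M * v₁) * (27 * (1 / Λ)) := mul_le_mul_of_nonneg_left h2 hMv.le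
      _ = 1 / (128 * Real.exp 1 ^ 2) := by rw [hΛdef]; field_simp; ring
  have he0 : 0 < Real.exp 1 ^ 2 := by positivity
  have hlam64 : (K : ℝ) * ((profileOf a₂ ha ha0).M * v₁ * σ₁ ^ 3) ≤ 1 / (64 * Real.exp 1 ^ 2) :=
    hlam.trans (by rw [div_le_div_iff₀ (by positivity) (by positivity)]; linarith only [he0])
  have hlamhalf : (K : ℝ) * ((profileOf a₂ ha ha0).M * v₁ * σ₁ ^ 3) ≤ 1 / 2 :=
    hlam.trans (by rw [div_le_div_iff₀ (by positivity) (by positivity)]; nlinarith only [he2])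
  -- the constants of the stub
  refine ⟨1 / 2, by norm_num, q / 8, by positivity, 8 * q, by positivity, cL / (2 * Real.sqrt q),
    by positivity, ⌈2 * max ν₀ 36 / q⌉₊ + 1, ?_⟩
  intro N hN μ hμ hlo hhi
  rw [← hqdef] at hlo hhi
  have hN1 : (1 : ℝ) ≤ N := by exact_mod_cast (le_trans (Nat.le_add_left 1 _) hN)
  have hN0 : (0 : ℝ) < ((N + 1 : ℕ) : ℝ) := by positivity
  have hNq : max ν₀ 36 ≤ q * (((N + 1 : ℕ) : ℝ)) / 2 := by
    have h1 : 2 * max ν₀ 36 / q ≤ (⌈2 * max ν₀ 36 / q⌉₊ : ℝ) := Nat.le_ceil _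
    have h2 : ((⌈2 * max ν₀ 36 / q⌉₊ + 1 : ℕ) : ℝ) ≤ N := by exact_mod_cast hN
    push_cast at h2 ⊢
    rw [div_le_iff₀ hq] at h1
    nlinarith only [h1, h2, hq]
  -- the count family, in the vocabulary of the line
  obtain ⟨hp, hsum, hp0, hrat, hg0, hg1⟩ := countWeight_countFamily a₂ θ₂ u₂ ha hθ hu ha0 hθ0 σ₁ μ N hμ
  have hmean : meanCount σ₁ (localGibbsProfile a₂ u₂ θ₂) μ N =
      ∑' n, countWeight σ₁ (localGibbsProfile a₂ u₂ θ₂) μ N n * (n : ℝ) := rfl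
  have hvarc : varCount σ₁ (localGibbsProfile a₂ u₂ θ₂) μ N =
      ∑' n, countWeight σ₁ (localGibbsProfile a₂ u₂ θ₂) μ N n * (n : ℝ) ^ 2 -
        (∑' n, countWeight σ₁ (localGibbsProfile a₂ u₂ θ₂) μ N n * (n : ℝ)) ^ 2 := rfl
  rw [hmean] at hlo hhi
  rw [hvarc, hmean]
  generalize hpdef : countWeight σ₁ (localGibbsProfile a₂ u₂ θ₂) μ N = p at hp hsum hp0 hrat hlo hhi ⊢
  generalize hνdef : μ * ∫ y, a₂ y = ν at hrat
  have hν : 0 < ν := by rw [← hνdef]; exact mul_pos hμ hcI0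
  -- the rescaled system: `L = K (N+1)` labels at the same diameter `ε = hsDiameter σ₁ N`
  obtain ⟨L, hLdef⟩ : ∃ L : ℕ, L = K * (N + 1) := ⟨_, rfl⟩
  have hL1 : 1 ≤ L := by
    rw [hLdef]; exact Nat.succ_le_of_lt (Nat.mul_pos (by omega) (Nat.succ_pos N))
  have hLcast : (L : ℝ) = K * (((N + 1 : ℕ) : ℝ)) := by rw [hLdef]; push_cast; ring
  have hL1' : L - 1 + 1 = L := Nat.sub_add_cancel hL1
  obtain ⟨σ', hσ'def⟩ : ∃ σ' : ℝ, σ' = hsDiameter σ₁ N * ((L : ℝ)) ^ (1 / 3 : ℝ) := ⟨_, rfl⟩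
  have hεσ : hsDiameter σ' (L - 1) = hsDiameter σ₁ N := by rw [hσ'def]; exact hsDiameter_rescale _ hL1
  have hov : ovDensity (profileOf a₂ ha ha0) σ' = K * ((profileOf a₂ ha ha0).M * v₁ * σ₁ ^ 3) := by
    rw [hσ'def, hLdef]; exact ovDensity_rescale _ σ₁ N K
  have hσ'pos : 0 < σ' := by
    have hL0 : (0 : ℝ) < L := by exact_mod_cast hL1
    rw [hσ'def]; exact mul_pos (hsDiameter_pos hσ₁ N) (Real.rpow_pos_of_pos hL0 _)
  have hσ's : σ' < σs := by
    have e1 : σ' ^ 3 = (K : ℝ) * σ₁ ^ 3 := by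
      rw [hσ'def, rescale_pow_three, hsDiameter_pow_three, hLcast]
      field_simp
    have h5 : (3 * σ₀) ^ 3 ≤ σs ^ 3 := pow_le_pow_left₀ (by positivity) (by linarith only [hσ₀s]) 3
    have h3 : σ' ^ 3 < σs ^ 3 := by
      rw [e1]
      have h6 : (3 * σ₀) ^ 3 = 27 * σ₀ ^ 3 := by ring
      linarith only [hKσ, h5, h6]
    exact lt_of_pow_lt_pow_left₀ 3 hσs.le h3
  have hSD' : SmallDensity (profileOf a₂ ha ha0) σ' := (hSD σ' hσ'pos hσ's).1
  have hsmall' : ovDensity (profileOf a₂ ha ha0) σ' ≤ 1 / (64 * Real.exp 1 ^ 2) := by rw [hov]; exact hlam64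
  -- insertion structure on `[0, L - 1]`, then abstract the insertion probabilities `g`
  obtain ⟨hgl, hgD⟩ := insertion_structure hSD' hsmall' (L - 1)
  rw [hεσ, hov] at hgl hgD
  rw [hL1', hLcast] at hgD
  obtain ⟨g, hgdef⟩ : ∃ g : ℕ → ℝ, ∀ n, g n = Xi (profileOf a₂ ha ha0) (hsDiameter σ₁ N) (n + 1) (n + 1) /
      Xi (profileOf a₂ ha ha0) (hsDiameter σ₁ N) n n := ⟨fun n => _, fun n => rfl⟩
  simp only [← hgdef] at hrat hg0 hg1 hgl hgD
  generalize hlamdef : (K : ℝ) * ((profileOf a₂ ha ha0).M * v₁ * σ₁ ^ 3) = lam at hgl hgD hlam hlam64 hlamhalf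
  have hlam0 : 0 ≤ lam := by rw [← hlamdef]; positivity
  generalize hDdef : 64 * Real.exp 1 ^ 2 * lam / ((K : ℝ) * ((N + 1 : ℕ) : ℝ)) = D at hgD
  have hD0 : 0 ≤ D := by rw [← hDdef]; positivity
  -- a priori bounds on the activity: `q (N+1)/2 ≤ ν ≤ 4 q (N+1)`
  have hνlo : q * ((N + 1 : ℕ) : ℝ) / 2 ≤ ν := by
    have := mean_le hp hsum hrat hg0 hg1 hν
    linarith only [this, hlo]
  have hνhi : ν ≤ 4 * (q * ((N + 1 : ℕ) : ℝ)) := by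
    obtain ⟨h1, h2⟩ := mean_ge hp hsum hrat hg0 hg1 hν (G := L - 1) (lam := lam) hgl
    have h3 := sum_add_tail hsum (L - 1 + 1)
    rw [hL1'] at h1 h2 h3
    rw [Nat.cast_sub hL1, Nat.cast_one, sub_add_cancel, hLcast] at h2
    have hT0 : 0 ≤ ∑' k, p (k + L) := tsum_nonneg fun k => hp _
    have h4 : (K : ℝ) * ((N + 1 : ℕ) : ℝ) * ∑' k, p (k + L) ≤ (1 + 1 / 2) * (q * ((N + 1 : ℕ) : ℝ)) :=
      h2.trans hhi
    -- the far tail is `≤ 1/16`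
    have h5 : ∑' k, p (k + L) ≤ 1 / 16 := by
      have h6 : ((N + 1 : ℕ) : ℝ) * ((K : ℝ) * ∑' k, p (k + L)) ≤ ((N + 1 : ℕ) : ℝ) * ((1 + 1 / 2) * q) := by
        have e : (K : ℝ) * ((N + 1 : ℕ) : ℝ) * ∑' k, p (k + L) = ((N + 1 : ℕ) : ℝ) * ((K : ℝ) * ∑' k, p (k + L)) := by
          ring
        have e' : (1 + 1 / 2) * (q * ((N + 1 : ℕ) : ℝ)) = ((N + 1 : ℕ) : ℝ) * ((1 + 1 / 2) * q) := by ring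
        rw [← e, ← e']; exact h4
      have h7 : (K : ℝ) * ∑' k, p (k + L) ≤ (1 + 1 / 2) * q := le_of_mul_le_mul_left h6 hN0
      have h8 : (24 * q + 2) * ∑' k, p (k + L) ≤ (K : ℝ) * ∑' k, p (k + L) :=
        mul_le_mul_of_nonneg_right hK1 hT0
      nlinarith only [h7, h8, hT0, hq]
    have h6 : 15 / 16 ≤ ∑ n ∈ Finset.range L, p n := by linarith only [h3, h5]
    have h8 : 1 / 2 ≤ 1 - lam := by linarith only [hlamhalf]
    have h9 : ν * (1 - lam) * ∑ n ∈ Finset.range L, p n ≤ (1 + 1 / 2) * (q * ((N + 1 : ℕ) : ℝ)) :=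
      h1.trans hhi
    have h10 : ν * (1 / 2) * (15 / 16) ≤ ν * (1 - lam) * ∑ n ∈ Finset.range L, p n :=
      mul_le_mul (mul_le_mul_of_nonneg_left h8 hν.le) h6 (by norm_num)
        (mul_nonneg hν.le (by linarith only [h8]))
    have hqN : 0 ≤ q * ((N + 1 : ℕ) : ℝ) := by positivity
    linarith only [h9, h10, hqN]
  have hν36 : max ν₀ 36 ≤ ν := hNq.trans hνlo
  have hν32 : 32 ≤ ν := le_trans (by linarith only [le_max_right ν₀ 36]) hν36
  have hνν₀ : ν₀ ≤ ν := (le_max_left _ _).trans hν36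
  -- the length of the good segment and the Lipschitz constant
  have hG : 4 * ν + 3 ≤ ((L - 1 : ℕ) : ℝ) := by
    rw [Nat.cast_sub hL1, Nat.cast_one, hLcast]
    have h1 : (24 * q + 2) * ((N + 1 : ℕ) : ℝ) ≤ (K : ℝ) * ((N + 1 : ℕ) : ℝ) :=
      mul_le_mul_of_nonneg_right hK1 hN0.le
    have h2 : ((N + 1 : ℕ) : ℝ) = (N : ℝ) + 1 := by push_cast; ring
    have hνhi' := hνhi
    rw [h2] at h1 hνhi' ⊢
    have hqN : 0 ≤ q * (N : ℝ) := mul_nonneg hq.le (Nat.cast_nonneg N)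
    nlinarith only [hνhi', h1, hN1, hq, hqN]
  have hνD : ν * D ≤ 1 / 8 := by
    rw [← hDdef]
    have e1 : ν * (64 * Real.exp 1 ^ 2 * lam / ((K : ℝ) * ((N + 1 : ℕ) : ℝ))) =
        (ν / ((N + 1 : ℕ) : ℝ)) * (64 * Real.exp 1 ^ 2 * (lam / K)) := by
      field_simp
    rw [e1]
    have h1 : ν / ((N + 1 : ℕ) : ℝ) ≤ 4 * q := by rw [div_le_iff₀ hN0]; linarith only [hνhi]
    have h2 : 24 * q * (lam / K) ≤ 1 / (128 * Real.exp 1 ^ 2) := by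
      refine le_trans ?_ hlam
      have hX : lam / K = (profileOf a₂ ha ha0).M * v₁ * σ₁ ^ 3 := by
        rw [← hlamdef]; field_simp
      rw [hX]
      calc 24 * q * ((profileOf a₂ ha ha0).M * v₁ * σ₁ ^ 3) ≤ (K : ℝ) * ((profileOf a₂ ha ha0).M * v₁ * σ₁ ^ 3) :=
            mul_le_mul_of_nonneg_right (by linarith only [hK1]) (by positivity)
        _ = lam := hlamdef
    have hlK : 0 ≤ lam / K := by positivity
    calc ν / ((N + 1 : ℕ) : ℝ) * (64 * Real.exp 1 ^ 2 * (lam / K))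
        ≤ (4 * q) * (64 * Real.exp 1 ^ 2 * (lam / K)) := mul_le_mul_of_nonneg_right h1 (by positivity)
      _ = (32 * Real.exp 1 ^ 2 / 3) * (24 * q * (lam / K)) := by ring
      _ ≤ (32 * Real.exp 1 ^ 2 / 3) * (1 / (128 * Real.exp 1 ^ 2)) :=
          mul_le_mul_of_nonneg_left h2 (by positivity)
      _ = 1 / 12 := by field_simp; ring
      _ ≤ 1 / 8 := by norm_num
  -- (b) and (c) from the abstract theory
  have hV := countFamily_variance p g ν lam D (L - 1) hp hsum hrat hg0 hg1 hν32 hG hlamhalf hgl hD0 hgD hνD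
  have hC := HL p g ν lam D (L - 1) hp hsum hp0 hrat hg0 hg1 hνν₀ hG hlamhalf hgl hD0 hgD hνD
  refine ⟨by linarith only [hV.1, hνlo], by linarith only [hV.2, hνhi], fun n hn => ?_⟩
  have h1 := hC n hn
  -- `√ν ≤ 2 √q √(N+1)`
  have hsq : Real.sqrt ν ≤ 2 * Real.sqrt q * Real.sqrt ((N + 1 : ℕ) : ℝ) := by
    rw [mul_assoc, ← Real.sqrt_mul hq.le, show (2 : ℝ) = Real.sqrt 4 by
      rw [show (4 : ℝ) = 2 ^ 2 by norm_num, Real.sqrt_sq (by norm_num)], ← Real.sqrt_mul (by norm_num)]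
    exact Real.sqrt_le_sqrt (by linarith only [hνhi])
  have hq2 : 0 < 2 * Real.sqrt q := by positivity
  rw [div_le_iff₀ hq2]
  calc cL ≤ Real.sqrt ν * p n := h1
    _ ≤ (2 * Real.sqrt q * Real.sqrt ((N + 1 : ℕ) : ℝ)) * p n := mul_le_mul_of_nonneg_right hsq (hp n)
    _ = Real.sqrt ((N + 1 : ℕ) : ℝ) * p n * (2 * Real.sqrt q) := by ring

end

end Summit.AtomisticToContinuum.HydrodynamicLimit.Theorems.LightConeInLawSVC.CountLCLT
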